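import Summits.ValiantsHypothesis.ValiantsHypothesis.Theorems.BarrierLeverPartitionMinorsChowBoundedSize

/-!
# Route BarrierLever — Chow witnesses for partition minors (item 20172, CPM): the LOCKED-AND-UNPEELABLE
# core engine (locked-core engine + rank-one peel + support bound)

Helper file (`--supports stmt-ValiantsHypothesis-20172`; cell valiant-natproofs, rung V4, 𝒟-side of
door (c); seat val-np-p4 gen 11; planner valiant-natproofs-p1 g15's MEMO-normalforms §5 request
«core := locked ∧ unpeelable»).  Closes NO item.

`chow_hit_of_core` — **if every CORE layout is hit then every injective layout is hit**, where a core
layout `(u, w)` of height `h` and size `r` is: injective, LOCKED (no literal class of the rows has the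
size of a literal class of the columns — else `chow_pairSplit` / `chow_pairSplit_mixed` split it), NOT
PEELABLE (for no pair `(a, c)` are both `i ↦ u i \\ a` and `j ↦ w j \\ c` injective — else `chow_peel`
peels it) and — a consequence recorded as a usable hypothesis — of size `r ≥ h + 1`
(`succ_le_of_unpeelable`: an unpeelable side spans `𝔽₂^h` by differences).  The induction is on the
height, exactly as in `chow_height_le_of_lockedCore`, with the peel tried first.

So a minimal layout missed by all products of `h + h` affine forms, if any, is locked, unpeelable on
the row side or on the column side, and has at least `h + 1` rows.

WHAT THIS IS NOT: an organising principle for finite checks and for the search of counterexamples;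
nothing on items 20172 / 20195 / 19717 themselves, on crux stmt-ValiantsHypothesis-14610, or on `VP`
versus `VNP`.
-/

set_option linter.dupNamespace false

namespace Summit.ValiantsHypothesis.ValiantsHypothesis.Theorems.BarrierLever.ChowFactor

open Finset MvPolynomial
open Summit.ValiantsHypothesis.ValiantsHypothesis.Theorems.BarrierLever.Compression
  (exists_blockPerm)

noncomputable section

/-- **CORE ENGINE.**  If every injective layout `(u, w)` (height `h`, size `r`) that is LOCKED, NOT
PEELABLE at any pair of coordinates and has `h + 1 ≤ r` is hit by a product of `h + h` affine forms,
then every injective layout is hit. -/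
theorem chow_hit_of_core
    (core : ∀ (h r : ℕ) (u w : Fin r → Finset (Fin h)), Function.Injective u → Function.Injective w →
      (∀ (a c : Fin h) (β γ : Bool),
        (Finset.univ.filter fun i => (a ∈ u i ↔ β = true)).card ≠
          (Finset.univ.filter fun j => (c ∈ w j ↔ γ = true)).card) →
      (∀ a c : Fin h, ¬ (Function.Injective (fun i => (u i).erase a) ∧
        Function.Injective (fun j => (w j).erase c))) →
      h + 1 ≤ r →
      ∃ ℓ : Fin (h + h) → MvPolynomial (Fin (h + h)) ℂ, (∀ q, (ℓ q).totalDegree ≤ 1) ∧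
        (Matrix.of fun i j : Fin r => coeff
          (∑ b ∈ u i, Finsupp.single (Fin.castAdd h b) 1 + ∑ d ∈ w j, Finsupp.single (Fin.natAdd h d) 1)
          (∏ q, ℓ q)).det ≠ 0)
    (h r : ℕ) (u w : Fin r → Finset (Fin h)) (hu : Function.Injective u)
    (hw : Function.Injective w) :
    ∃ ℓ : Fin (h + h) → MvPolynomial (Fin (h + h)) ℂ, (∀ q, (ℓ q).totalDegree ≤ 1) ∧
      (Matrix.of fun i j : Fin r => coeff
        (∑ b ∈ u i, Finsupp.single (Fin.castAdd h b) 1 + ∑ d ∈ w j, Finsupp.single (Fin.natAdd h d) 1)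
        (∏ q, ℓ q)).det ≠ 0 := by
  classical
  induction h generalizing r with
  | zero =>
    -- height 0: at most one row, the empty product hits it
    exact chow_hit_height_zero r u w hu
  | succ h ih =>
    -- peel first
    by_cases hpeel : ∃ a c : Fin (h + 1), Function.Injective (fun i => (u i).erase a) ∧
        Function.Injective (fun j => (w j).erase c)
    · obtain ⟨a, c, hua, hwc⟩ := hpeel
      exact chow_peel a c u w (ih _ _ _ (preimage_succAbove_injective_of_erase a u hua)
        (preimage_succAbove_injective_of_erase c w hwc))
    push Not at hpeel
    have hpeel' : ∀ a c : Fin (h + 1), ¬ (Function.Injective (fun i => (u i).erase a) ∧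
        Function.Injective (fun j => (w j).erase c)) := fun a c hac => hpeel a c hac.1 hac.2
    -- the support bound for an unpeelable side
    have hsize : h + 1 + 1 ≤ r := by
      by_cases hrow : ∀ a : Fin (h + 1), ¬ Function.Injective (fun i => (u i).erase a)
      · exact succ_le_of_unpeelable u (Nat.succ_pos h)
          (fun a => exists_erase_eq_of_not_injective u hu a (hrow a))
      · push Not at hrow
        obtain ⟨a, ha⟩ := hrow
        exact succ_le_of_unpeelable w (Nat.succ_pos h)
          (fun c => exists_erase_eq_of_not_injective w hw c (hpeel a c ha))
    -- locked: core; unlocked: split (verbatim the locked-core engine)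
    by_cases hlk : ∀ (a c : Fin (h + 1)) (β γ : Bool),
        (Finset.univ.filter fun i => (a ∈ u i ↔ β = true)).card ≠
          (Finset.univ.filter fun j => (c ∈ w j ↔ γ = true)).card
    · exact core (h + 1) r u w hu hw hlk hpeel' hsize
    push Not at hlk
    obtain ⟨a, c, β, γ, hk⟩ := hlk
    rw [card_filter_iff_eq, card_filter_iff_eq] at hk
    have hua := card_filter_mem_add_card_filter_not_mem u a
    have hwc := card_filter_mem_add_card_filter_not_mem w c
    have key : (Finset.univ.filter fun i => a ∉ u i).card = (Finset.univ.filter fun j => c ∉ w j).card ∨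
        (Finset.univ.filter fun i => a ∉ u i).card = (Finset.univ.filter fun j => c ∈ w j).card := by
      cases β <;> cases γ <;> simp only [Bool.false_eq_true, if_false, if_true] at hk <;> omega
    obtain ⟨k₀, hk₀⟩ : ∃ k₀, (Finset.univ.filter fun i => a ∉ u i).card = k₀ := ⟨_, rfl⟩
    rw [hk₀] at key hua
    obtain ⟨m, hkm⟩ : ∃ m, r = k₀ + m := ⟨r - k₀, by omega⟩
    subst hkm
    obtain ⟨σ, hσ1, hσ2⟩ := exists_blockPerm (Finset.univ.filter fun i => a ∉ u i) hk₀
    have hu0 : ∀ i : Fin k₀, a ∉ u (σ (Fin.castAdd m i)) := fun i => by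
      have := hσ1 i
      rw [Finset.mem_filter] at this
      exact this.2
    have hu1 : ∀ i : Fin m, a ∈ u (σ (Fin.natAdd k₀ i)) := fun i => by
      have := hσ2 i
      rw [Finset.mem_filter] at this
      by_contra hna
      exact this ⟨Finset.mem_univ _, hna⟩
    have hU0 := preimage_succAbove_injective_of_not_mem a (fun i => u (σ (Fin.castAdd m i)))
      (fun i j hij => Fin.castAdd_injective _ _ (σ.injective (hu hij))) hu0
    have hU1 := preimage_succAbove_injective_of_mem a (fun i => u (σ (Fin.natAdd k₀ i)))
      (fun i j hij => Fin.natAdd_injective _ _ (σ.injective (hu hij))) hu1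
    rcases key with hkk | hkk
    · obtain ⟨τ, hτ1, hτ2⟩ := exists_blockPerm (Finset.univ.filter fun j => c ∉ w j) hkk.symm
      have hw0 : ∀ j : Fin k₀, c ∉ w (τ (Fin.castAdd m j)) := fun j => by
        have := hτ1 j
        rw [Finset.mem_filter] at this
        exact this.2
      have hw1 : ∀ j : Fin m, c ∈ w (τ (Fin.natAdd k₀ j)) := fun j => by
        have := hτ2 j
        rw [Finset.mem_filter] at this
        by_contra hnc
        exact this ⟨Finset.mem_univ _, hnc⟩
      have hW0 := preimage_succAbove_injective_of_not_mem c (fun j => w (τ (Fin.castAdd m j)))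
        (fun i j hij => Fin.castAdd_injective _ _ (τ.injective (hw hij))) hw0
      have hW1 := preimage_succAbove_injective_of_mem c (fun j => w (τ (Fin.natAdd k₀ j)))
        (fun i j hij => Fin.natAdd_injective _ _ (τ.injective (hw hij))) hw1
      exact chow_hit_of_perm u w σ τ (chow_pairSplit a c (fun i => u (σ i)) (fun j => w (τ j))
        hu0 hu1 hw0 hw1 (ih k₀ _ _ hU0 hW0) (ih m _ _ hU1 hW1))
    · obtain ⟨τ, hτ1, hτ2⟩ := exists_blockPerm (Finset.univ.filter fun j => c ∈ w j) hkk.symm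
      have hw0 : ∀ j : Fin k₀, c ∈ w (τ (Fin.castAdd m j)) := fun j => by
        have := hτ1 j
        rw [Finset.mem_filter] at this
        exact this.2
      have hw1 : ∀ j : Fin m, c ∉ w (τ (Fin.natAdd k₀ j)) := fun j => by
        have := hτ2 j
        rw [Finset.mem_filter] at this
        intro hc
        exact this ⟨Finset.mem_univ _, hc⟩
      have hW0 := preimage_succAbove_injective_of_mem c (fun j => w (τ (Fin.castAdd m j)))
        (fun i j hij => Fin.castAdd_injective _ _ (τ.injective (hw hij))) hw0
      have hW1 := preimage_succAbove_injective_of_not_mem c (fun j => w (τ (Fin.natAdd k₀ j)))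
        (fun i j hij => Fin.natAdd_injective _ _ (τ.injective (hw hij))) hw1
      exact chow_hit_of_perm u w σ τ (chow_pairSplit_mixed a c (fun i => u (σ i)) (fun j => w (τ j))
        hu0 hu1 hw0 hw1 (ih k₀ _ _ hU0 hW0) (ih m _ _ hU1 hW1))

/-- **Contrapositive: the structure of a minimal missed layout.**  If some injective layout is NOT
hit, then some injective layout that is locked, unpeelable at every pair of coordinates and of size
`r ≥ h + 1` is not hit either. -/
theorem exists_core_of_not_hit {h r : ℕ} (u w : Fin r → Finset (Fin h)) (hu : Function.Injective u)
    (hw : Function.Injective w)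
    (hnot : ¬ ∃ ℓ : Fin (h + h) → MvPolynomial (Fin (h + h)) ℂ, (∀ q, (ℓ q).totalDegree ≤ 1) ∧
      (Matrix.of fun i j : Fin r => coeff
        (∑ b ∈ u i, Finsupp.single (Fin.castAdd h b) 1 + ∑ d ∈ w j, Finsupp.single (Fin.natAdd h d) 1)
        (∏ q, ℓ q)).det ≠ 0) :
    ∃ (h' r' : ℕ) (u' w' : Fin r' → Finset (Fin h')), Function.Injective u' ∧ Function.Injective w' ∧
      (∀ (a c : Fin h') (β γ : Bool),
        (Finset.univ.filter fun i => (a ∈ u' i ↔ β = true)).card ≠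
          (Finset.univ.filter fun j => (c ∈ w' j ↔ γ = true)).card) ∧
      (∀ a c : Fin h', ¬ (Function.Injective (fun i => (u' i).erase a) ∧
        Function.Injective (fun j => (w' j).erase c))) ∧
      h' + 1 ≤ r' ∧
      ¬ ∃ ℓ : Fin (h' + h') → MvPolynomial (Fin (h' + h')) ℂ, (∀ q, (ℓ q).totalDegree ≤ 1) ∧
        (Matrix.of fun i j : Fin r' => coeff
          (∑ b ∈ u' i, Finsupp.single (Fin.castAdd h' b) 1 + ∑ d ∈ w' j, Finsupp.single (Fin.natAdd h' d) 1)
          (∏ q, ℓ q)).det ≠ 0 := by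
  by_contra hall
  push Not at hall
  exact hnot (chow_hit_of_core
    (fun h r u w hu hw hlk hpl hsz => hall h r u w hu hw hlk (fun a c h1 h2 => hpl a c ⟨h1, h2⟩) hsz)
    h r u w hu hw)

end

end Summit.ValiantsHypothesis.ValiantsHypothesis.Theorems.BarrierLever.ChowFactor
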